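import Mathlib
import Literature.MathematicalPhysics.KineticTheory.HardSphereEuler
import Literature.Analysis.FunctionSpaces.TorusSpaceTime
import HarnessLib

/-!
# Crux `NearConstantShortTimeHL` (stmt-AtomisticToContinuum-12502), line `small-tilt-domination`:
# stub `exists_bounds_moduli_of_isSmoothSpaceTimeOn`

`C¹` size bounds, time-Lipschitz bounds and spatial moduli of continuity (in the minimal-image
distance `Torus.euclidDist`), uniform on a compact time interval `[0, t]`, `t < T`, of a space–time
field `f : ℝ → 𝕋³ → F'` that is jointly smooth on `[0, T) × 𝕋³`
(`Torus.IsSmoothSpaceTimeOn (Ico 0 T) f`). The lead applies it to the three log-profile rows of a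
classical hard-sphere Euler solution.

Route (folklore real analysis): the lift `G = Torus.stLift f` is `C^∞` on the slab
`s = [0, T) × ℝ³`, a set of unique differentiability, so `G` and `DG = fderivWithin ℝ G s` are
continuous on `s`; `f r x`, `∂ₜ f (r, x)` (`Torus.timeDerivWithin`) and `∂ᵢ (f r) (x)`
(`Torus.partialDeriv`) are the values of `G`, `DG (1, 0)` and `DG (0, eᵢ)` at `(r, a)` for any lift
`a` of `x` (`IsSmoothSpaceTimeOn.timeDerivWithin_apply_proj`, `IsSmoothSpaceTimeOn.fderiv_slice_apply`,
`partialDeriv_eq_fderiv_apply`). On the compact set `K = [0, t] × B̄(0, R + 1)`, `R` a bound for the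
fundamental-domain representatives, `G` and `DG` are bounded and uniformly continuous; two torus
points at minimal-image distance `δ < 1` have lifts `a`, `a - reprSym (x - y)` in `B̄(0, R + 1)` at
distance `δ`. The time-Lipschitz bound is the one-variable mean value inequality on `[0, t]`.

No definitions, no named facts.
-/

noncomputable section

namespace Summit.AtomisticToContinuum.HydrodynamicLimit.Theorems.NearConstantShortTimeHL

open scoped BigOperators ENNReal
open MeasureTheory Set Filter
open Literature.MathematicalPhysics.KineticTheory Literature.Analysis.FluidPDE Literature.Analysis.FunctionSpaces

/-! ### Lifts realising the minimal-image distance -/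

/-- Given a lift `a ∈ ℝ³` of `x ∈ 𝕋³` and any `y ∈ 𝕋³`, the point `a - reprSym (x - y)` is a lift
of `y`; its distance to `a` is the minimal-image distance `euclidDist x y = ‖reprSym (x - y)‖`.
[folklore] -/
theorem proj_sub_reprSym_sub_eq {x y : T3} {a : V3} (ha : Torus.proj a = x) :
    Torus.proj (a - Torus.reprSym (x - y)) = y := by
  rw [sub_eq_add_neg, Torus.proj_add, Torus.proj_neg, ha, Torus.proj_reprSym, ← sub_eq_add_neg,
    sub_sub_cancel]

/-- Two points of `𝕋³` admit lifts to `ℝ³` whose distance is their minimal-image distance, the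
first of them being the fundamental-domain representative. [folklore] -/
theorem exists_lifts_norm_sub_eq_euclidDist (x y : T3) :
    ∃ a b : V3, Torus.proj a = x ∧ Torus.proj b = y ∧ a = Torus.repr x ∧
      ‖a - b‖ = Torus.euclidDist x y :=
  ⟨Torus.repr x, Torus.repr x - Torus.reprSym (x - y), Torus.proj_repr x,
    proj_sub_reprSym_sub_eq (Torus.proj_repr x), rfl, by
      rw [sub_sub_cancel, Torus.euclidDist_eq]⟩

/-! ### The stub -/

/-- **`C¹` bounds, time-Lipschitz bounds and spatial moduli of continuity on `[0, t] × 𝕋³`,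
`t < T`, of a field jointly smooth on `[0, T) × 𝕋³`.** There is `Λ > 0` bounding `‖f‖`,
`‖∂ₜ f‖` (one-sided within `[0, T)`) and all `‖∂ᵢ f‖` on `[0, t] × 𝕋³` and serving as a Lipschitz
constant in time, and for every `e > 0` a radius `d > 0` such that `f r`, `∂ₜ f (r, ·)` and the
`∂ᵢ (f r)` vary by at most `e` on minimal-image balls of radius `d`, uniformly in `r ∈ [0, t]`
(continuity of the lift and of its derivative within the slab on a compact set of lifts; mean
value inequality in time). [folklore] -/
theorem exists_bounds_moduli_of_isSmoothSpaceTimeOn : ∀ {F' : Type*} [NormedAddCommGroup F'] [NormedSpace ℝ F'] {T t : ℝ} {f : ℝ → T3 → F'}, Torus.IsSmoothSpaceTimeOn (Set.Ico 0 T) f → 0 ≤ t → t < T → (∃ Λ : ℝ, 0 < Λ ∧ (∀ r ∈ Set.Icc 0 t, ∀ x, ‖f r x‖ ≤ Λ ∧ ‖Torus.timeDerivWithin (Set.Ico 0 T) f r x‖ ≤ Λ ∧ ∀ i, ‖Torus.partialDeriv i (f r) x‖ ≤ Λ) ∧ ∀ r ∈ Set.Icc 0 t, ∀ r' ∈ Set.Icc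 0 t, ∀ x, ‖f r x - f r' x‖ ≤ Λ * |r - r'|) ∧ (∀ e : ℝ, 0 < e → ∃ d : ℝ, 0 < d ∧ ∀ r ∈ Set.Icc 0 t, ∀ x y : T3, Torus.euclidDist x y < d → ‖f r x - f r y‖ ≤ e ∧ ‖Torus.timeDerivWithin (Set.Ico 0 T) f r x - Torus.timeDerivWithin (Set.Ico 0 T) f r y‖ ≤ e ∧ ∀ i, ‖Torus.partialDeriv i (f r) x - Torus.partialDeriv i (f r) y‖ ≤ e) := by
  intro F' _ _ T t f hf _ht0 htT
  -- the slab `[0, T) × ℝ³` is a set of unique differentiability containing `[0, t] × ℝ³`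
  have hS : UniqueDiffOn ℝ (Ico (0 : ℝ) T) := uniqueDiffOn_Ico 0 T
  have hU : UniqueDiffOn ℝ (Ico (0 : ℝ) T ×ˢ (univ : Set V3)) := hS.prod uniqueDiffOn_univ
  have hIcc : Icc (0 : ℝ) t ⊆ Ico 0 T := fun r hr => ⟨hr.1, hr.2.trans_lt htT⟩
  -- the lift and its derivative within the slab are continuous on the slab
  have hGc : ContinuousOn (Torus.stLift f) (Ico (0 : ℝ) T ×ˢ (univ : Set V3)) :=
    hf.continuousOn_stLift
  have hDc : ContinuousOn (fderivWithin ℝ (Torus.stLift f) (Ico (0 : ℝ) T ×ˢ (univ : Set V3)))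
      (Ico (0 : ℝ) T ×ˢ (univ : Set V3)) :=
    hf.continuousOn_fderivWithin hU (by simp)
  -- a ball containing all fundamental-domain representatives, and the compact set `K`
  obtain ⟨R, hR⟩ :=
    (Torus.isCompact_toLp_image_pi_Icc (d := Fin 3)).isBounded.subset_closedBall (0 : V3)
  have hreprR : ∀ x : T3, ‖Torus.repr x‖ ≤ R := fun x =>
    mem_closedBall_zero_iff.1 (hR (Torus.repr_mem_toLp_image_pi_Icc x))
  set K : Set (ℝ × V3) := Icc (0 : ℝ) t ×ˢ Metric.closedBall (0 : V3) (R + 1) with hK_def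
  have hK : IsCompact K := isCompact_Icc.prod (isCompact_closedBall _ _)
  have hKs : K ⊆ Ico (0 : ℝ) T ×ˢ (univ : Set V3) := prod_mono hIcc (subset_univ _)
  have hmemK : ∀ r ∈ Icc (0 : ℝ) t, ∀ a : V3, ‖a‖ ≤ R + 1 → (r, a) ∈ K := fun r hr a ha =>
    mk_mem_prod hr (mem_closedBall_zero_iff.2 ha)
  have hreprK : ∀ r ∈ Icc (0 : ℝ) t, ∀ x : T3, (r, Torus.repr x) ∈ K := fun r hr x =>
    hmemK r hr _ ((hreprR x).trans (by linarith))
  -- `f`, `∂ₜ f` and `∂ᵢ f` at `(r, proj a)` are values of the lift and of its derivative at `(r, a)`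
  have e0 : ∀ (r : ℝ) (a : V3), f r (Torus.proj a) = Torus.stLift f (r, a) := fun _ _ => rfl
  have e1 : ∀ r ∈ Ico (0 : ℝ) T, ∀ a : V3, Torus.timeDerivWithin (Ico 0 T) f r (Torus.proj a) =
      fderivWithin ℝ (Torus.stLift f) (Ico 0 T ×ˢ univ) (r, a) (1, 0) := fun r hr a =>
    hf.timeDerivWithin_apply_proj hS hr a
  have e2 : ∀ r ∈ Ico (0 : ℝ) T, ∀ (a : V3) (i : Fin 3),
      Torus.partialDeriv i (f r) (Torus.proj a) =
        fderivWithin ℝ (Torus.stLift f) (Ico 0 T ×ˢ univ) (r, a) (0, EuclideanSpace.single i 1) :=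
    fun r hr a i => by
      rw [Torus.partialDeriv_eq_fderiv_apply ((hf.isSmooth_slice hr).isContDiff (by simp)) i,
        hf.fderiv_slice_apply hr]
  -- the direction vectors have norm at most one
  have n1 : ‖((1 : ℝ), (0 : V3))‖ ≤ 1 := by simp [Prod.norm_def]
  have n2 : ∀ i : Fin 3, ‖((0 : ℝ), (EuclideanSpace.single i (1 : ℝ) : V3))‖ ≤ 1 := fun i => by
    simp [Prod.norm_def]
  -- sup bounds on `K`
  obtain ⟨C₀, hC₀⟩ := hK.exists_bound_of_continuousOn (hGc.mono hKs)
  obtain ⟨C₁, hC₁⟩ := hK.exists_bound_of_continuousOn (hDc.mono hKs)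
  have hΛ₀ : C₀ ≤ |C₀| + |C₁| + 1 := by linarith [le_abs_self C₀, abs_nonneg C₁]
  have hΛ₁ : C₁ ≤ |C₀| + |C₁| + 1 := by linarith [le_abs_self C₁, abs_nonneg C₀]
  have hb : ∀ r ∈ Icc (0 : ℝ) t, ∀ x : T3, ‖f r x‖ ≤ |C₀| + |C₁| + 1 ∧
      ‖Torus.timeDerivWithin (Ico 0 T) f r x‖ ≤ |C₀| + |C₁| + 1 ∧
      ∀ i, ‖Torus.partialDeriv i (f r) x‖ ≤ |C₀| + |C₁| + 1 := by
    intro r hr x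
    have hrS : r ∈ Ico (0 : ℝ) T := hIcc hr
    obtain ⟨a, rfl, haK⟩ : ∃ a : V3, Torus.proj a = x ∧ (r, a) ∈ K :=
      ⟨Torus.repr x, Torus.proj_repr x, hreprK r hr x⟩
    refine ⟨?_, ?_, fun i => ?_⟩
    · rw [e0]
      exact (hC₀ _ haK).trans hΛ₀
    · rw [e1 r hrS]
      exact ((ContinuousLinearMap.unit_le_opNorm _ _ n1).trans (hC₁ _ haK)).trans hΛ₁
    · rw [e2 r hrS]
      exact ((ContinuousLinearMap.unit_le_opNorm _ _ (n2 i)).trans (hC₁ _ haK)).trans hΛ₁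
  refine ⟨⟨|C₀| + |C₁| + 1, by positivity, hb, ?_⟩, ?_⟩
  · -- time-Lipschitz bound: mean value inequality on the convex set `[0, t]`
    intro r hr r' hr' x
    have hderiv : ∀ τ ∈ Icc (0 : ℝ) t, HasDerivWithinAt (fun τ => f τ x)
        (Torus.timeDerivWithin (Ico 0 T) f τ x) (Icc 0 t) τ := fun τ hτ =>
      (hf.hasDerivWithinAt_slice (hIcc hτ) x).mono hIcc
    have h := (convex_Icc (0 : ℝ) t).norm_image_sub_le_of_norm_hasDerivWithin_le hderiv
      (fun τ hτ => (hb τ hτ x).2.1) hr' hr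
    rwa [Real.norm_eq_abs] at h
  · -- spatial moduli of continuity: uniform continuity of the lift and its derivative on `K`
    intro e he
    obtain ⟨δ₀, hδ₀, h₀⟩ := Metric.uniformContinuousOn_iff_le.1
      (hK.uniformContinuousOn_of_continuous (hGc.mono hKs)) e he
    obtain ⟨δ₁, hδ₁, h₁⟩ := Metric.uniformContinuousOn_iff_le.1
      (hK.uniformContinuousOn_of_continuous (hDc.mono hKs)) e he
    refine ⟨min 1 (min δ₀ δ₁), lt_min one_pos (lt_min hδ₀ hδ₁), ?_⟩
    intro r hr x y hxy
    have hrS : r ∈ Ico (0 : ℝ) T := hIcc hr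
    obtain ⟨a, b, hpa, hpb, har, hab⟩ := exists_lifts_norm_sub_eq_euclidDist x y
    rw [← hab] at hxy
    have hv1 : ‖a - b‖ < 1 := lt_of_lt_of_le hxy (min_le_left _ _)
    have hvδ₀ : ‖a - b‖ ≤ δ₀ := (lt_of_lt_of_le hxy ((min_le_right _ _).trans (min_le_left _ _))).le
    have hvδ₁ : ‖a - b‖ ≤ δ₁ :=
      (lt_of_lt_of_le hxy ((min_le_right _ _).trans (min_le_right _ _))).le
    have haR : ‖a‖ ≤ R := har ▸ hreprR x
    have haK : (r, a) ∈ K := hmemK r hr a (haR.trans (by linarith))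
    have hbK : (r, b) ∈ K := hmemK r hr b (by
      calc ‖b‖ = ‖a - (a - b)‖ := by rw [sub_sub_cancel]
        _ ≤ ‖a‖ + ‖a - b‖ := norm_sub_le _ _
        _ ≤ R + 1 := add_le_add haR hv1.le)
    have hdist : dist ((r, a) : ℝ × V3) (r, b) = ‖a - b‖ := by
      rw [Prod.dist_eq, dist_self, dist_eq_norm, max_eq_right (norm_nonneg _)]
    have hG := h₀ _ haK _ hbK (hdist.le.trans hvδ₀)
    have hD := h₁ _ haK _ hbK (hdist.le.trans hvδ₁)
    rw [dist_eq_norm] at hG hD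
    subst hpa hpb
    refine ⟨?_, ?_, fun i => ?_⟩
    · rw [e0, e0]
      exact hG
    · rw [e1 r hrS a, e1 r hrS b, ← sub_apply]
      exact (ContinuousLinearMap.unit_le_opNorm _ _ n1).trans hD
    · rw [e2 r hrS a i, e2 r hrS b i, ← sub_apply]
      exact (ContinuousLinearMap.unit_le_opNorm _ _ (n2 i)).trans hD

end Summit.AtomisticToContinuum.HydrodynamicLimit.Theorems.NearConstantShortTimeHL

end
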